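import Literature.Analysis.FluidPDE.BoussinesqPartialViscosityGlobal
import HarnessLib

/-!
# Kiselev–Park–Yao 2022, Theorem 1.1 and Proposition 2.4: small-scale formation for the VISCOUS
# 2-D Boussinesq equation (`ν > 0`, no thermal diffusion) in the mirror class — algebraic floor and
# sub-exponential ceiling for `‖ρ(t)‖_{H^s}` as `t → ∞` (named facts)

A. Kiselev, J. Park, Y. Yao, *Small scale formation for the 2D Boussinesq equation*, Anal. PDE
(2025) = arXiv:2211.05070 (held text `paper:arxiv-2211.05070`; §1.1 p0003 L26–L33 assumptions,
p0004 L3–L24 Theorem 1.1 and Remark 1.2, §2 p0010 L36–L42 Proposition 2.4). The companion file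
`BoussinesqSmallScaleFormation.lean` types the INVISCID theorems 1.3/1.4/1.7 of the same paper; this
file types its viscous §2 (system: `ρₜ + u·∇ρ = 0`, `uₜ + u·∇u = −∇p − ρe₂ + νΔu`, `∇·u = 0`,
`ν > 0`, `Ω = ℝ²` or `𝕋² = (−π, π]²`, p0003 L3–L13).

Assumptions (A1)–(A3) [p0003 L26–L33]: "(A1) `ρ₀, u₀ ∈ C^∞(Ω)`. If `Ω = ℝ²`, assume in addition
that `ρ₀, u₀ ∈ C_c^∞(ℝ²)`. (A2) `ρ₀` and `u₀₂` are odd in `x₂`, and `u₀₁` is even in `x₂`. If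
`Ω = 𝕋²`, assume in addition that `ρ₀` and `u₀₂` are even in `x₁`, `u₀₁` is odd in `x₁`, and `ρ₀ = 0`
on the `x₂`-axis. (A3) `ρ₀` is not identically zero, and `ρ₀ ≥ 0` for `x₂ ≥ 0`."

> **Theorem 1.1** [p0004 L3–L14]. Assume `ν > 0`, and let `Ω = ℝ²` or `𝕋²`. For any initial data
> `(ρ₀, u₀)` satisfying (A1)–(A3), the global-in-time smooth solution `(ρ, u)` to (1.1) satisfies the
> following: if `Ω = ℝ²`, `limsup_{t→∞} t^{−s/10} ‖ρ(t)‖_{Ḣ^s(Ω)} = +∞` for all `s ≥ 1`; if `Ω = 𝕋²`,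
> `limsup_{t→∞} t^{−s(2s−1)/(8s−2)} ‖ρ(t)‖_{Ḣ^s(Ω)} = +∞` for all `s ≥ 1`.
>
> **Proposition 2.4** [p0010 L36–L42] (Remark 1.2: "following the arguments similar to Kukavica–Wang").
> Let `Ω = ℝ²` or `𝕋²`. For any initial data `(ρ₀, u₀)` satisfying (A1)–(A3), `‖ρ(t)‖_{H¹(Ω)}`
> satisfies the sub-exponential bound `‖ρ(t)‖_{H¹(Ω)} ≲ exp(Ct^α)` for all `t > 0` for some constant
> `α ∈ (0, 1)`. ("Therefore in this setting, the fastest possible growth rate of `‖ρ(t)‖_{H¹}` is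
> somewhere between algebraic and sub-exponential.")

## Contents

* `torusCell` — the fundamental cell `(−π, π]²` of `𝕋²`, over which the periodic norms are taken;
* NAMED FACTS (net debt +3): `KiselevParkYao2022_viscousSobolevGrowth_plane` (Thm 1.1, `Ω = ℝ²`),
  `KiselevParkYao2022_viscousSobolevGrowth_torus` (Thm 1.1, `Ω = 𝕋²`),
  `KiselevParkYao2022_viscousH1SubexponentialBound` (Prop. 2.4, both domains);
* PROVED readings: `KiselevParkYao2022_viscousSobolevGrowth_plane.not_bounded` (no uniform-in-time
  `Ḣ^m` bound, `m ≥ 1`, for the global viscous mirror-class solution) and the torus twin.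

## Why the cell wants it (ns-blowup D-0081 §A1, zone Z8 stage 2; with `BoussinesqPartialViscosityGlobal`)

Zone Z8-1M's Boussinesq MIRROR class is (A2) verbatim (`HOME/profile/z8/SHEET.md` §1: "`ρ, ω, ψ`
ODD in `s` (`u_ζ` even, `u_s` odd in `s`) … 4-fold class = Kiselev–Park–Yao 2022/25 VERBATIM"). Its
stage 2 (viscous continuation, START-HERE D0081 §Z8) for the Boussinesq MODEL at fixed `ν > 0` is
framed by two printed theorems: NO finite-time collapse (Chae 2006 Thm 1.1,
`chae2006_boussinesq_zeroDiffusivity_global`) and — this file — growth that IS infinite but only in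
INFINITE time: `‖ρ(t)‖_{Ḣ^s}` exceeds `C t^{s/10}` (`ℝ²`) resp. `C t^{s(2s−1)/(8s−2)}` (`𝕋²`) along a
sequence of times for every `C`, while `‖ρ(t)‖_{H¹} ≲ exp(Ct^α)`, `α < 1` (Prop. 2.4). A viscous
mirror-class run therefore has a pre-lettered printed shape: regular, potential energy monotone
(KPY §2.1), algebraic-or-faster but sub-exponential small-scale growth.

## Rendering notes (read before citing)

* "The global-in-time smooth solution": typed as EVERY classical solution `(u, p, ρ)` of the viscous
  system on `[0, ∞) × ℝ²` from the data (`IsClassicalBoussinesqDiffusiveOnPlane (Ici 0) ν 0 u p (−ρ)`: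
  the tree's partial-viscosity class has Chae's sign `+θe₂`, so `θ = −ρ`) whose Sobolev norms of all
  orders are bounded on every `[0, T]` (`ℝ²` case; such a solution is the unique one of
  `chae2006_boussinesq_zeroDiffusivity_global`) resp. which is doubly `2π`-periodic (`𝕋²` case; smooth
  periodic solutions are unique by the classical energy argument, Hu–Kukavica–Ziane 2013 — hedge).
* `Ḣ^s`, `s ≥ 1` real, is typed for INTEGER `s = m ≥ 1` through `∫ ‖D^m ρ(t)‖²` (`iteratedFDeriv`;
  equivalent to `‖ρ‖²_{Ḣ^m}` up to constants depending on `m`, which the `limsup = +∞` statement does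
  not see); `limsup_{t→∞} t^{−a}‖ρ(t)‖ = +∞` is typed as "for every `C` and every `t₀` some `t ≥ t₀`,
  `t > 0`, has `‖D^m ρ(t)‖²_{L²} > (C t^a)²`". The `𝕋²` norms are integrals over the cell `(−π, π]²`
  (`torusCell`); the `H¹` norm of Prop. 2.4 is `∫ρ² + ∫‖Dρ‖²`, and "`≲ exp(Ct^α)`" is typed as
  `∃ α ∈ (0,1), ∃ C K, ∀ t > 0, ‖ρ(t)‖²_{H¹} ≤ (K e^{C t^α})²` (constants depending on the data and `ν`).
* (A3)'s "`ρ₀ ≥ 0` for `x₂ ≥ 0`" is typed on `{x₂ ≥ 0}` for `ℝ²` and on the half-cell `{x₂ ∈ [0, π]}`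
  for `𝕋²` (with oddness in `x₂` and `2π`-periodicity this is the printed sign pattern of Fig. 1);
  "`ρ₀ = 0` on the `x₂`-axis" is `ρ₀ x = 0` whenever `x₁ = 0`.

WHAT THIS IS NOT: not Navier–Stokes, not Euler — the 2-D viscous Boussinesq MODEL; printed theorems
typed as cited, unasserted `Prop`s plus two proved readings.

## Mathlib / tree search

Tree: `IsClassicalBoussinesqDiffusiveOnPlane`, `Boussinesq.HasBoundedSobolevNormsOn`,
`chae2006_boussinesq_zeroDiffusivity_global` (`BoussinesqPartialViscosityGlobal`); `IsDoublyPeriodic`,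
`IsOddInCoord`, `IsEvenInCoord`, `flipCoord`, the inviscid facts `KiselevParkYao2022_torusGradientGrowth`
/ `_stripGrowth` / `_annulusSwirlGrowth` (`BoussinesqSmallScaleFormation`); no viscous Boussinesq growth
statement (`lean search 'KiselevParkYao2022_viscous|subexponential.*Boussinesq'` = 0 hits). Mathlib:
`iteratedFDeriv`, `lintegral`, `Real.one_le_rpow`.

## References

* A. Kiselev, J. Park, Y. Yao, Anal. PDE (2025) = arXiv:2211.05070: §1.1 (A1)–(A3) (p. 3), Thm 1.1 and
  Rem. 1.2 (p. 4), Prop. 2.4 (p. 10). [`KiselevParkYao2022`]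
* I. Kukavica, W. Wang, 2020 (the `exp(Ct)` / `W^{2,p}` bounds behind Prop. 2.4; KPY ref. [KW2020]).
* D. Chae, Adv. Math. 203 (2006) 497–513 (global existence and uniqueness, `ℝ²`).
  [`Chae2006Boussinesq`]
-/

noncomputable section

open MeasureTheory Set Function Filter TopologicalSpace Real
open _root_.Topology
open scoped ContDiff NNReal ENNReal

namespace Literature.Analysis.FluidPDE

/-- The fundamental cell `(−π, π]²` of the torus `𝕋² = (−π, π]²` (KPY §1 setting, p0003 L13); the
`𝕋²` Sobolev norms below are integrals of doubly `2π`-periodic functions over this cell.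
[cite: KiselevParkYao2022, §1 setting (arXiv:2211.05070 p0003 L13)] -/
def torusCell : Set (EuclideanSpace ℝ (Fin 2)) :=
  {x | x 0 ∈ Ioc (-π) π ∧ x 1 ∈ Ioc (-π) π}

/-- Membership in the cell. [cite: KiselevParkYao2022, §1 setting (arXiv:2211.05070 p0003 L13)] -/
@[simp] theorem mem_torusCell {x : EuclideanSpace ℝ (Fin 2)} :
    x ∈ torusCell ↔ x 0 ∈ Ioc (-π) π ∧ x 1 ∈ Ioc (-π) π :=
  Iff.rfl

/-! ### The named facts -/

/-- **Kiselev–Park–Yao 2022, Theorem 1.1, case `Ω = ℝ²` (viscous Boussinesq, mirror class: algebraic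
small-scale growth).** Printed: "Assume `ν > 0` … For any initial data `(ρ₀, u₀)` satisfying (A1)–(A3),
the global-in-time smooth solution `(ρ, u)` … satisfies `limsup_{t→∞} t^{−s/10} ‖ρ(t)‖_{Ḣ^s(ℝ²)} = +∞`
for all `s ≥ 1`." **Rendering** (module docstring): for `ν > 0` and smooth compactly supported data
with `ρ₀`, `u₀₂` odd and `u₀₁` even in `x₂`, `ρ₀ ≢ 0`, `ρ₀ ≥ 0` on `{x₂ ≥ 0}`: every classical solution
`(u, p, ρ)` of the viscous system on `[0, ∞) × ℝ²` from the data with Sobolev norms of all orders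
bounded on every `[0, T]` satisfies, for every integer `m ≥ 1`, every `C` and every `t₀`: some
`t ≥ t₀`, `t > 0`, has `∫ ‖D^m ρ(t)‖² > (C t^{m/10})²`.
[cite: KiselevParkYao2022, Theorem 1.1 case Ω = ℝ² with (A1)–(A3) (arXiv:2211.05070 p0003 L26–L33, p0004 L3–L9)] -/
def KiselevParkYao2022_viscousSobolevGrowth_plane : Prop :=
  ∀ (ν : ℝ), 0 < ν →
    ∀ (u₀ : EuclideanSpace ℝ (Fin 2) → EuclideanSpace ℝ (Fin 2)) (ρ₀ : EuclideanSpace ℝ (Fin 2) → ℝ),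
      ContDiff ℝ ∞ u₀ → ContDiff ℝ ∞ ρ₀ → HasCompactSupport u₀ → HasCompactSupport ρ₀ →
      IsOddInCoord 1 ρ₀ → IsOddInCoord 1 (fun x => u₀ x 1) → IsEvenInCoord 1 (fun x => u₀ x 0) →
      (∃ x, ρ₀ x ≠ 0) → (∀ x : EuclideanSpace ℝ (Fin 2), 0 ≤ x 1 → 0 ≤ ρ₀ x) →
      ∀ (u : ℝ → EuclideanSpace ℝ (Fin 2) → EuclideanSpace ℝ (Fin 2))
        (p ρ : ℝ → EuclideanSpace ℝ (Fin 2) → ℝ),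
        IsClassicalBoussinesqDiffusiveOnPlane (Ici 0) ν 0 u p (fun t x => -ρ t x) →
        u 0 = u₀ → ρ 0 = ρ₀ →
        (∀ T : ℝ, 0 ≤ T → Boussinesq.HasBoundedSobolevNormsOn (Icc 0 T) u (fun t x => -ρ t x)) →
        ∀ m : ℕ, 1 ≤ m → ∀ C t₀ : ℝ, ∃ t : ℝ, t₀ ≤ t ∧ 0 < t ∧
          ENNReal.ofReal ((C * t ^ ((m : ℝ) / 10)) ^ 2) <
            ∫⁻ x, ‖iteratedFDeriv ℝ m (ρ t) x‖ₑ ^ 2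

/-- **Kiselev–Park–Yao 2022, Theorem 1.1, case `Ω = 𝕋²` (viscous Boussinesq, 4-fold mirror class:
algebraic small-scale growth).** Printed: "… if `Ω = 𝕋²`, we have
`limsup_{t→∞} t^{−s(2s−1)/(8s−2)} ‖ρ(t)‖_{Ḣ^s(Ω)} = +∞` for all `s ≥ 1`." **Rendering**: for `ν > 0`
and smooth doubly `2π`-periodic data with `ρ₀`, `u₀₂` odd and `u₀₁` even in `x₂`, `ρ₀`, `u₀₂` even and
`u₀₁` odd in `x₁`, `ρ₀ = 0` on the `x₂`-axis, `ρ₀ ≢ 0`, `ρ₀ ≥ 0` on `{x₂ ∈ [0, π]}`: every doubly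
`2π`-periodic classical solution `(u, p, ρ)` of the viscous system on `[0, ∞) × ℝ²` from the data
satisfies, for every integer `m ≥ 1`, every `C`, `t₀`: some `t ≥ t₀`, `t > 0`, has
`∫_{(−π,π]²} ‖D^m ρ(t)‖² > (C t^{m(2m−1)/(8m−2)})²`.
[cite: KiselevParkYao2022, Theorem 1.1 case Ω = 𝕋² with (A1)–(A3) (arXiv:2211.05070 p0003 L26–L33, p0004 L3–L14)] -/
def KiselevParkYao2022_viscousSobolevGrowth_torus : Prop :=
  ∀ (ν : ℝ), 0 < ν →
    ∀ (u₀ : EuclideanSpace ℝ (Fin 2) → EuclideanSpace ℝ (Fin 2)) (ρ₀ : EuclideanSpace ℝ (Fin 2) → ℝ),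
      ContDiff ℝ ∞ u₀ → ContDiff ℝ ∞ ρ₀ → IsDoublyPeriodic (2 * π) u₀ → IsDoublyPeriodic (2 * π) ρ₀ →
      IsOddInCoord 1 ρ₀ → IsOddInCoord 1 (fun x => u₀ x 1) → IsEvenInCoord 1 (fun x => u₀ x 0) →
      IsEvenInCoord 0 ρ₀ → IsEvenInCoord 0 (fun x => u₀ x 1) → IsOddInCoord 0 (fun x => u₀ x 0) →
      (∀ x : EuclideanSpace ℝ (Fin 2), x 0 = 0 → ρ₀ x = 0) →
      (∃ x, ρ₀ x ≠ 0) → (∀ x : EuclideanSpace ℝ (Fin 2), x 1 ∈ Icc 0 π → 0 ≤ ρ₀ x) →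
      ∀ (u : ℝ → EuclideanSpace ℝ (Fin 2) → EuclideanSpace ℝ (Fin 2))
        (p ρ : ℝ → EuclideanSpace ℝ (Fin 2) → ℝ),
        IsClassicalBoussinesqDiffusiveOnPlane (Ici 0) ν 0 u p (fun t x => -ρ t x) →
        (∀ t : ℝ, 0 ≤ t → IsDoublyPeriodic (2 * π) (u t) ∧ IsDoublyPeriodic (2 * π) (p t) ∧
          IsDoublyPeriodic (2 * π) (ρ t)) →
        u 0 = u₀ → ρ 0 = ρ₀ →
        ∀ m : ℕ, 1 ≤ m → ∀ C t₀ : ℝ, ∃ t : ℝ, t₀ ≤ t ∧ 0 < t ∧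
          ENNReal.ofReal ((C * t ^ ((m : ℝ) * (2 * m - 1) / (8 * m - 2))) ^ 2) <
            ∫⁻ x in torusCell, ‖iteratedFDeriv ℝ m (ρ t) x‖ₑ ^ 2

/-- **Kiselev–Park–Yao 2022, Proposition 2.4 (sub-exponential ceiling for `‖ρ(t)‖_{H¹}`, `ν > 0`).**
Printed: "Let `Ω = ℝ²` or `𝕋²`. For any initial data `(ρ₀, u₀)` satisfying (A1)–(A3), `‖ρ(t)‖_{H¹(Ω)}`
satisfies the sub-exponential bound `‖ρ(t)‖_{H¹(Ω)} ≲ exp(Ct^α)` for all `t > 0` for some constant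
`α ∈ (0, 1)`." **Rendering**: in the setting of the two facts above (same data classes, same solution
classes) there are `α ∈ (0, 1)` and constants `C`, `K` such that
`∫ρ(t)² + ∫‖Dρ(t)‖² ≤ (K exp(C t^α))²` for all `t > 0` (integrals over `ℝ²`, resp. over the cell
`(−π, π]²`). [cite: KiselevParkYao2022, Proposition 2.4 and Remark 1.2 (arXiv:2211.05070 p0010 L36–L42, p0004 L18–L24)] -/
def KiselevParkYao2022_viscousH1SubexponentialBound : Prop :=
  (∀ (ν : ℝ), 0 < ν →
    ∀ (u₀ : EuclideanSpace ℝ (Fin 2) → EuclideanSpace ℝ (Fin 2)) (ρ₀ : EuclideanSpace ℝ (Fin 2) → ℝ),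
      ContDiff ℝ ∞ u₀ → ContDiff ℝ ∞ ρ₀ → HasCompactSupport u₀ → HasCompactSupport ρ₀ →
      IsOddInCoord 1 ρ₀ → IsOddInCoord 1 (fun x => u₀ x 1) → IsEvenInCoord 1 (fun x => u₀ x 0) →
      (∃ x, ρ₀ x ≠ 0) → (∀ x : EuclideanSpace ℝ (Fin 2), 0 ≤ x 1 → 0 ≤ ρ₀ x) →
      ∀ (u : ℝ → EuclideanSpace ℝ (Fin 2) → EuclideanSpace ℝ (Fin 2))
        (p ρ : ℝ → EuclideanSpace ℝ (Fin 2) → ℝ),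
        IsClassicalBoussinesqDiffusiveOnPlane (Ici 0) ν 0 u p (fun t x => -ρ t x) →
        u 0 = u₀ → ρ 0 = ρ₀ →
        (∀ T : ℝ, 0 ≤ T → Boussinesq.HasBoundedSobolevNormsOn (Icc 0 T) u (fun t x => -ρ t x)) →
        ∃ α : ℝ, 0 < α ∧ α < 1 ∧ ∃ C K : ℝ, ∀ t : ℝ, 0 < t →
          (∫⁻ x, ‖ρ t x‖ₑ ^ 2) + (∫⁻ x, ‖fderiv ℝ (ρ t) x‖ₑ ^ 2) ≤
            ENNReal.ofReal ((K * Real.exp (C * t ^ α)) ^ 2)) ∧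
  (∀ (ν : ℝ), 0 < ν →
    ∀ (u₀ : EuclideanSpace ℝ (Fin 2) → EuclideanSpace ℝ (Fin 2)) (ρ₀ : EuclideanSpace ℝ (Fin 2) → ℝ),
      ContDiff ℝ ∞ u₀ → ContDiff ℝ ∞ ρ₀ → IsDoublyPeriodic (2 * π) u₀ → IsDoublyPeriodic (2 * π) ρ₀ →
      IsOddInCoord 1 ρ₀ → IsOddInCoord 1 (fun x => u₀ x 1) → IsEvenInCoord 1 (fun x => u₀ x 0) →
      IsEvenInCoord 0 ρ₀ → IsEvenInCoord 0 (fun x => u₀ x 1) → IsOddInCoord 0 (fun x => u₀ x 0) →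
      (∀ x : EuclideanSpace ℝ (Fin 2), x 0 = 0 → ρ₀ x = 0) →
      (∃ x, ρ₀ x ≠ 0) → (∀ x : EuclideanSpace ℝ (Fin 2), x 1 ∈ Icc 0 π → 0 ≤ ρ₀ x) →
      ∀ (u : ℝ → EuclideanSpace ℝ (Fin 2) → EuclideanSpace ℝ (Fin 2))
        (p ρ : ℝ → EuclideanSpace ℝ (Fin 2) → ℝ),
        IsClassicalBoussinesqDiffusiveOnPlane (Ici 0) ν 0 u p (fun t x => -ρ t x) →
        (∀ t : ℝ, 0 ≤ t → IsDoublyPeriodic (2 * π) (u t) ∧ IsDoublyPeriodic (2 * π) (p t) ∧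
          IsDoublyPeriodic (2 * π) (ρ t)) →
        u 0 = u₀ → ρ 0 = ρ₀ →
        ∃ α : ℝ, 0 < α ∧ α < 1 ∧ ∃ C K : ℝ, ∀ t : ℝ, 0 < t →
          (∫⁻ x in torusCell, ‖ρ t x‖ₑ ^ 2) + (∫⁻ x in torusCell, ‖fderiv ℝ (ρ t) x‖ₑ ^ 2) ≤
            ENNReal.ofReal ((K * Real.exp (C * t ^ α)) ^ 2))

/-! ### Readings (proved): no uniform-in-time `Ḣ^m` bound in the viscous mirror class -/

/-- From `C t^a` with `t ≥ 1`, `C ≥ 1`, `a ≥ 0`: the threshold `(C t^a)²` dominates `C`.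
[cite: KiselevParkYao2022, Theorem 1.1 (arXiv:2211.05070 p0004 L3–L14)] -/
private theorem le_sq_mul_rpow {C t a : ℝ} (hC : 1 ≤ C) (ht : 1 ≤ t) (ha : 0 ≤ a) :
    C ≤ (C * t ^ a) ^ 2 := by
  have h1 : 1 ≤ t ^ a := Real.one_le_rpow ht ha
  have h2 : C ≤ C * t ^ a := le_mul_of_one_le_right (by linarith) h1
  have h3 : 1 ≤ C * t ^ a := hC.trans h2
  calc C ≤ C * t ^ a := h2
    _ ≤ (C * t ^ a) ^ 2 := by nlinarith

/-- **Reading of Theorem 1.1 (`ℝ²`): along the global viscous mirror-class solution `‖D^m ρ(t)‖_{L²}`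
is NOT bounded in time**, `m ≥ 1`: for every `B` some `t ≥ 0` has `∫ ‖D^m ρ(t)‖² > B`.
[cite: KiselevParkYao2022, Theorem 1.1 case Ω = ℝ² (arXiv:2211.05070 p0004 L3–L9)] -/
theorem KiselevParkYao2022_viscousSobolevGrowth_plane.not_bounded
    (h : KiselevParkYao2022_viscousSobolevGrowth_plane) {ν : ℝ} (hν : 0 < ν)
    {u₀ : EuclideanSpace ℝ (Fin 2) → EuclideanSpace ℝ (Fin 2)} {ρ₀ : EuclideanSpace ℝ (Fin 2) → ℝ}
    (h1 : ContDiff ℝ ∞ u₀) (h2 : ContDiff ℝ ∞ ρ₀) (h3 : HasCompactSupport u₀)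
    (h4 : HasCompactSupport ρ₀) (h5 : IsOddInCoord 1 ρ₀) (h6 : IsOddInCoord 1 (fun x => u₀ x 1))
    (h7 : IsEvenInCoord 1 (fun x => u₀ x 0)) (h8 : ∃ x, ρ₀ x ≠ 0)
    (h9 : ∀ x : EuclideanSpace ℝ (Fin 2), 0 ≤ x 1 → 0 ≤ ρ₀ x)
    {u : ℝ → EuclideanSpace ℝ (Fin 2) → EuclideanSpace ℝ (Fin 2)}
    {p ρ : ℝ → EuclideanSpace ℝ (Fin 2) → ℝ}
    (hsol : IsClassicalBoussinesqDiffusiveOnPlane (Ici 0) ν 0 u p (fun t x => -ρ t x))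
    (hu0 : u 0 = u₀) (hρ0 : ρ 0 = ρ₀)
    (hreg : ∀ T : ℝ, 0 ≤ T → Boussinesq.HasBoundedSobolevNormsOn (Icc 0 T) u (fun t x => -ρ t x))
    {m : ℕ} (hm : 1 ≤ m) (B : ℝ) :
    ∃ t : ℝ, 0 ≤ t ∧ ENNReal.ofReal B < ∫⁻ x, ‖iteratedFDeriv ℝ m (ρ t) x‖ₑ ^ 2 := by
  obtain ⟨t, ht1, ht0, hlt⟩ :=
    h ν hν u₀ ρ₀ h1 h2 h3 h4 h5 h6 h7 h8 h9 u p ρ hsol hu0 hρ0 hreg m hm (max B 1) 1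
  refine ⟨t, ht0.le, lt_of_le_of_lt ?_ hlt⟩
  refine ENNReal.ofReal_le_ofReal ((le_max_left B 1).trans ?_)
  exact le_sq_mul_rpow (le_max_right B 1) ht1 (by positivity)

/-- **Reading of Theorem 1.1 (`𝕋²`): along the global viscous 4-fold mirror-class solution the cell
norm `‖D^m ρ(t)‖_{L²((−π,π]²)}` is NOT bounded in time**, `m ≥ 1`.
[cite: KiselevParkYao2022, Theorem 1.1 case Ω = 𝕋² (arXiv:2211.05070 p0004 L10–L14)] -/
theorem KiselevParkYao2022_viscousSobolevGrowth_torus.not_bounded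
    (h : KiselevParkYao2022_viscousSobolevGrowth_torus) {ν : ℝ} (hν : 0 < ν)
    {u₀ : EuclideanSpace ℝ (Fin 2) → EuclideanSpace ℝ (Fin 2)} {ρ₀ : EuclideanSpace ℝ (Fin 2) → ℝ}
    (h1 : ContDiff ℝ ∞ u₀) (h2 : ContDiff ℝ ∞ ρ₀) (h3 : IsDoublyPeriodic (2 * π) u₀)
    (h4 : IsDoublyPeriodic (2 * π) ρ₀) (h5 : IsOddInCoord 1 ρ₀)
    (h6 : IsOddInCoord 1 (fun x => u₀ x 1)) (h7 : IsEvenInCoord 1 (fun x => u₀ x 0))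
    (h8 : IsEvenInCoord 0 ρ₀) (h9 : IsEvenInCoord 0 (fun x => u₀ x 1))
    (h10 : IsOddInCoord 0 (fun x => u₀ x 0)) (h11 : ∀ x : EuclideanSpace ℝ (Fin 2), x 0 = 0 → ρ₀ x = 0)
    (h12 : ∃ x, ρ₀ x ≠ 0) (h13 : ∀ x : EuclideanSpace ℝ (Fin 2), x 1 ∈ Icc 0 π → 0 ≤ ρ₀ x)
    {u : ℝ → EuclideanSpace ℝ (Fin 2) → EuclideanSpace ℝ (Fin 2)}
    {p ρ : ℝ → EuclideanSpace ℝ (Fin 2) → ℝ}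
    (hsol : IsClassicalBoussinesqDiffusiveOnPlane (Ici 0) ν 0 u p (fun t x => -ρ t x))
    (hper : ∀ t : ℝ, 0 ≤ t → IsDoublyPeriodic (2 * π) (u t) ∧ IsDoublyPeriodic (2 * π) (p t) ∧
      IsDoublyPeriodic (2 * π) (ρ t))
    (hu0 : u 0 = u₀) (hρ0 : ρ 0 = ρ₀) {m : ℕ} (hm : 1 ≤ m) (B : ℝ) :
    ∃ t : ℝ, 0 ≤ t ∧ ENNReal.ofReal B < ∫⁻ x in torusCell, ‖iteratedFDeriv ℝ m (ρ t) x‖ₑ ^ 2 := by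
  obtain ⟨t, ht1, ht0, hlt⟩ := h ν hν u₀ ρ₀ h1 h2 h3 h4 h5 h6 h7 h8 h9 h10 h11 h12 h13 u p ρ hsol
    hper hu0 hρ0 m hm (max B 1) 1
  refine ⟨t, ht0.le, lt_of_le_of_lt ?_ hlt⟩
  refine ENNReal.ofReal_le_ofReal ((le_max_left B 1).trans ?_)
  have hm1 : (1 : ℝ) ≤ m := by exact_mod_cast hm
  have ha : 0 ≤ (m : ℝ) * (2 * m - 1) / (8 * m - 2) := by
    apply div_nonneg
    · nlinarith
    · linarith
  exact le_sq_mul_rpow (le_max_right B 1) ht1 ha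

end Literature.Analysis.FluidPDE

end
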